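import Literature.NumberTheory.GaloisRepresentations.ContinuousH3
import Literature.NumberTheory.GaloisRepresentations.CohomologicalDimension
import Mathlib.Topology.Instances.ZMod
import HarnessLib

/-!
# A non-zero class in continuous `H³`: the cup product of three characters evaluated on three
# commuting elements — hence `¬ cd_ℓ(G) ≤ 2`

For a locally compact topological group `G`, a discrete commutative ring `M` viewed as a TRIVIAL
`G`-module, three continuous additive characters `χ₀ χ₁ χ₂ : G → M` and three pairwise commuting
elements `b₀ b₁ b₂ ∈ G` with `χᵢ(bⱼ) = δᵢⱼ`, the triple cup product `χ₀ ∪ χ₁ ∪ χ₂` — the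
continuous inhomogeneous `3`-cocycle

  `f(σ, τ, υ) = χ₀(σ) · χ₁(τ) · χ₂(υ)`

(Neukirch–Schmidt–Wingberg, *Cohomology of Number Fields*, I §4 (1.4.1)/(1.4.4): the cup product
of inhomogeneous cochains on a trivial module is the product of the values at consecutive
arguments) — has NON-ZERO class in Mathlib's continuous cohomology `continuousCohomology 3`
(through the tree's inhomogeneous description `threeCocycleClass` / `threeCocycleClass_eq_zero_iff`
of `ContinuousH3.lean`).  The witness is the alternating "torus" sum

  `J(E) = Σ_{σ ∈ S₃} sgn σ · E(b_{σ0}, b_{σ1}, b_{σ2})`: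

for an inhomogeneous COBOUNDARY `E(x, y, z) = β(y, z) - β(xy, z) + β(x, yz) - β(x, y)` it vanishes
identically as soon as the `bᵢ` commute (`torus_alternating_eq_zero`: the signed sum of the six
simplices is a cycle of the `3`-torus `⟨b₀, b₁, b₂⟩` — the `(12)`-, `(23)`- and `(123)`-cosets
cancel), while `J(f) = det (χᵢ(bⱼ)) = 1` (Brown, *Cohomology of Groups*, V §6: the cohomology ring
of `ℤ³` is exterior on three degree-one classes, detected by the fundamental class).

Consequences: **`H³_cont(G, M) ≠ 0`** (`not_subsingleton_continuousCohomology_three`) and, for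
`M = ℤ/ℓ`, **`¬ cd_ℓ(G) ≤ 2`** in the tree's sense `GroupCdLE`
(`not_groupCdLE_two_of_three_commuting`; Serre, *Cohomologie galoisienne*, I §3.1, and I §3.3
for the rank consequences).  Used by the abc-iut cell to bound the `ℓ`-ranks of closed abelian
subgroups of `Gal(F̄/F)` for a `p`-adic field `F` (`cd_ℓ ≤ 2`, `LocalFieldCdTwo.lean`), hence to
show they are topologically finitely generated.

PROOF-ONLY file (theorems only: the cocycle is built as a local term; no definition, no instance,
no `Prop`-valued fact).  Classical; nothing here bears on [IUTchIII] Cor. 3.12.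

## References
* J. Neukirch, A. Schmidt, K. Wingberg, *Cohomology of Number Fields*, 2nd ed. (2008), I §4
  (cup products of inhomogeneous cochains, (1.4.1)–(1.4.4)). [NeukirchSchmidtWingberg2008]
* J.-P. Serre, *Galois Cohomology* (1997), I §2.2 (continuous cochains), I §3.1 (`cd_p`),
  I §3.3. [SerreGaloisCohomology1997]
* K. S. Brown, *Cohomology of Groups*, GTM 87 (1982), V §6. [Brown1982]
-/

noncomputable section

open CategoryTheory Function

universe u v

namespace Literature.NumberTheory.GaloisRepresentations

open TopRep ContRepresentation ContinuousCohomology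

/-! ### The torus identity (pure algebra) -/

section Torus

variable {G : Type v} [Mul G] {M : Type u} [AddCommGroup M]

/-- **The torus identity.**  Let `β : G × G → M` be any function and
`E(x, y, z) = β(y, z) - β(xy, z) + β(x, yz) - β(x, y)` its inhomogeneous coboundary (trivial
action).  If `b₀ b₁ b₂` commute pairwise, then the alternating sum
`Σ_{σ ∈ S₃} sgn σ · E(b_{σ0}, b_{σ1}, b_{σ2})` vanishes: the signed sum of the six `3`-simplices
`[b_{σ0} | b_{σ1} | b_{σ2}]` is a cycle (the fundamental cycle of the `3`-torus), and a coboundary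
evaluates to `0` on it — the first/last faces cancel along the `(123)`-cosets, the two inner faces
along the `(12)`- and `(23)`-cosets. [cite: Brown1982, V §6] -/
theorem torus_alternating_eq_zero (β : G → G → M) (E : G → G → G → M)
    (hE : ∀ x y z, E x y z = β y z - β (x * y) z + β x (y * z) - β x y)
    {b₀ b₁ b₂ : G} (h₀₁ : b₀ * b₁ = b₁ * b₀) (h₀₂ : b₀ * b₂ = b₂ * b₀) (h₁₂ : b₁ * b₂ = b₂ * b₁) :
    E b₀ b₁ b₂ - E b₁ b₀ b₂ - E b₀ b₂ b₁ - E b₂ b₁ b₀ + E b₁ b₂ b₀ + E b₂ b₀ b₁ = 0 := by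
  simp only [hE]
  simp only [← h₀₁, ← h₀₂, ← h₁₂]
  abel

end Torus

/-! ### The triple cup product of three characters on a trivial module -/

section CupThree

variable {G : Type v} [Group G] [TopologicalSpace G] [IsTopologicalGroup G] [LocallyCompactSpace G]
variable {M : Type v} [CommRing M] [TopologicalSpace M] [DiscreteTopology M]

omit [IsTopologicalGroup G] [LocallyCompactSpace G] in
/-- The trivial representation acts trivially (unfolding through `toTopRep`). [folklore] -/
private theorem trivial_toTopRep_ρ_apply (g : G) (m : M) : (ContinuousRep.trivial G ℤ M).toTopRep.ρ g m = m := rfl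

/-- **`H³_cont(G, M) ≠ 0` detected by three commuting elements.**  Let `G` be a locally compact
topological group, `M` a non-trivial discrete commutative ring with TRIVIAL `G`-action,
`χ₀ χ₁ χ₂ : G → M` continuous additive characters and `b₀ b₁ b₂ ∈ G` pairwise commuting with
`χᵢ(bⱼ) = δᵢⱼ`.  Then Mathlib's `continuousCohomology 3` of the trivial module `M` is not a
subsingleton: the triple cup product `f(σ, τ, υ) = χ₀(σ) χ₁(τ) χ₂(υ)` is a continuous inhomogeneous
`3`-cocycle (the cocycle identity is a polynomial identity in the additive characters) whose class
is non-zero — were it an inhomogeneous coboundary `dβ` (`threeCocycleClass_eq_zero_iff`), the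
torus sum of `dβ` would be `0` (`torus_alternating_eq_zero`) while that of `f` is
`det (χᵢ(bⱼ)) = 1`. [cite: NeukirchSchmidtWingberg2008, I §4 (1.4.4)] [cite: Brown1982, V §6] -/
theorem not_subsingleton_continuousCohomology_three [Nontrivial M] (χ : Fin 3 → C(G, M))
    (b : Fin 3 → G) (hadd : ∀ i g h, χ i (g * h) = χ i g + χ i h)
    (hcomm : ∀ i j, b i * b j = b j * b i) (hδ : ∀ i j, χ i (b j) = if i = j then 1 else 0) :
    ¬ Subsingleton (continuousCohomology 3 (ContinuousRep.trivial G ℤ M).toTopRep) := by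
  intro hS
  -- (1) the triple cup product `f(σ, τ, υ) = χ₀ σ · χ₁ τ · χ₂ υ`, continuous since `M` is discrete
  let e : G × G × G → M × M × M := fun p => (χ 0 p.1, χ 1 p.2.1, χ 2 p.2.2)
  have he : Continuous e :=
    ((χ 0).continuous.comp continuous_fst).prodMk
      (((χ 1).continuous.comp (continuous_fst.comp continuous_snd)).prodMk
        ((χ 2).continuous.comp (continuous_snd.comp continuous_snd)))
  let f₀ : C(G × G × G, M) :=
    ⟨(fun q : M × M × M => q.1 * q.2.1 * q.2.2) ∘ e, continuous_of_discreteTopology.comp he⟩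
  have hf₀ : ∀ σ τ υ, f₀ (σ, τ, υ) = χ 0 σ * χ 1 τ * χ 2 υ := fun _ _ _ => rfl
  -- (2) it is an inhomogeneous `3`-cocycle for the trivial action
  have hmem : f₀ ∈ contThreeCocycles (ContinuousRep.trivial G ℤ M).toTopRep := by
    rw [mem_contThreeCocycles_iff]
    intro σ τ υ ω
    rw [trivial_toTopRep_ρ_apply, hf₀, hf₀, hf₀, hf₀, hf₀]
    simp only [hadd]
    ring
  -- (3) in a subsingleton `H³` its class vanishes, so `f = dβ`
  have hcls : threeCocycleClass (ContinuousRep.trivial G ℤ M).toTopRep ⟨f₀, hmem⟩ = 0 := Subsingleton.elim _ _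
  rw [threeCocycleClass_eq_zero_iff] at hcls
  obtain ⟨β, hβ⟩ := hcls
  have hE : ∀ x y z, χ 0 x * χ 1 y * χ 2 z =
      β (y, z) - β (x * y, z) + β (x, y * z) - β (x, y) := by
    intro x y z
    have h := hβ x y z
    rw [trivial_toTopRep_ρ_apply] at h
    rw [← hf₀]
    exact h
  -- (4) the torus identity for `dβ` contradicts `det (χᵢ(bⱼ)) = 1 ≠ 0`
  have hzero := torus_alternating_eq_zero (fun y z => β (y, z))
    (fun x y z => χ 0 x * χ 1 y * χ 2 z) hE (hcomm 0 1) (hcomm 0 2) (hcomm 1 2)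
  simp [hδ] at hzero

end CupThree

/-! ### `¬ cd_ℓ(G) ≤ 2` -/

/-- `ℤ/ℓ` is `ℓ`-primary torsion. [cite: SerreGaloisCohomology1997, I §3.1] -/
theorem isPrimaryTorsion_zmod (ℓ : ℕ) : IsPrimaryTorsion ℓ (ZMod ℓ) := by
  intro m
  refine ⟨1, ?_⟩
  rw [pow_one, nsmul_eq_mul, ZMod.natCast_self, zero_mul]

section Cd

variable {G : Type} [Group G] [TopologicalSpace G] [IsTopologicalGroup G] [LocallyCompactSpace G]

/-- **`¬ cd_ℓ(G) ≤ 2`** (`GroupCdLE G ℓ 2` fails) for a locally compact group `G` possessing three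
pairwise commuting elements `b₀ b₁ b₂` and three continuous additive characters
`χ₀ χ₁ χ₂ : G → ℤ/ℓ` with `χᵢ(bⱼ) = δᵢⱼ`: the trivial module `ℤ/ℓ` is `ℓ`-primary torsion and
`H³_cont(G, ℤ/ℓ) ≠ 0`.  (So such a `G` has `cd_ℓ ≥ 3`: e.g. any profinite group mapping onto
`(ℤ/ℓ)³` through three pairwise commuting lifts of a basis — Serre's `cd_p(ℤ_p^n) = n` /
`cd_p ≥` rank bounds.) [cite: SerreGaloisCohomology1997, I §3.1 and I §3.3] -/
theorem not_groupCdLE_two_of_three_commuting {ℓ : ℕ} [Fact ℓ.Prime]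
    (χ : Fin 3 → C(G, ZMod ℓ)) (b : Fin 3 → G)
    (hadd : ∀ i g h, χ i (g * h) = χ i g + χ i h) (hcomm : ∀ i j, b i * b j = b j * b i)
    (hδ : ∀ i j, χ i (b j) = if i = j then 1 else 0) :
    ¬ GroupCdLE G ℓ 2 := by
  intro hcd
  have h3 : Subsingleton (continuousCohomology 3 (ContinuousRep.trivial G ℤ (ZMod ℓ)).toTopRep) :=
    hcd (ZMod ℓ) (ContinuousRep.trivial G ℤ (ZMod ℓ)) (isPrimaryTorsion_zmod ℓ)
      (show 2 < 3 by norm_num)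
  exact not_subsingleton_continuousCohomology_three χ b hadd hcomm hδ h3

end Cd

end Literature.NumberTheory.GaloisRepresentations

end
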